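import Summits.QuantumFields.YangMills.Theorems.ColdStartUniversalityLatticeLangevinDossSussmannField
import HarnessLib

/-!
# Route `ColdStartUniversality` (fixed-cut-off SZZ dynamics; Doss–Sussmann smoothing programme, file 2):
# ★★ THE DOSS–SUSSMANN FLOW — a GLOBAL flow of the tamed random ODE, `C^∞` in the start with derivative bounds
# UNIFORM in the driving Brownian path, and `U = B · Φ^{B}(BᴴU(0))`

Helper file (seat `ym-line-csu-p1`, g24).  For a tamed Doss–Sussmann field `G` (`exists_tamed_dossSussmannField`: smooth,
equal to the raw field `F(p, M)_e = (p_e)ᴴ D_β(pM)_e p_e M_e` when `‖M‖ ≤ 1`, bounds `K` uniform over frames `‖p‖ ≤ 1`)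
and a physical horizon `T ≥ 0`:
* ★ `exists_dossSussmannFlow` — for EVERY continuous frame path `c : [0,1] → Cfg` with `‖c(τ)‖ ≤ 1` the rescaled
  path-driven equation `v(τ) = x + ∫₀^τ T·G(c(s), v(s)) ds` has a unique solution family `Φ^c x ∈ C([0,1], Cfg)` from
  every start `x`; `x ↦ Φ^c x` is `C^∞` and `‖D(x ↦ Φ^c x τ)‖ ≤ e^{TKτ}`, `‖Φ^c x τ − x‖ ≤ TKτ` — constants independent
  of the path `c` (tree: `Literature.Analysis.ODE.exists_pathDriven_solution_family`,
  `contDiff_pathDriven_solution_family`, `norm_fderiv_pathDriven_solution_family_eval_le`, g24).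
* ★★ `dossSussmann_isPathDrivenSolution` — for the SZZ pair (`B` free from `b`, `U` at coupling `β` from `x`, same
  flat noise): almost surely the rescaled conjugated path `τ ↦ (ρB(Tτ))ᴴ ρU(Tτ)` IS a solution of that equation driven
  by the frame path `τ ↦ ρB(Tτ)` (from `hasDerivWithinAt_dossSussmann_vec`; the taming is invisible because the path is
  unitary, `‖·‖ ≤ 1` entrywise), hence ★★ `dossSussmann_flow_representation`: `ρU_e(Tτ) = ρB_e(Tτ) · Φ^{ρB}((ρb)ᴴρx)(τ)_e`
  for every solution family `Φ` of the tamed equation — the N2 step of memo g23 §3: the SZZ solution is the free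
  Brownian motion times a smooth deterministic functional of the Brownian path and the start.
THEOREMS ONLY, no sorry.  HONEST FRAMING: fixed-cut-off calculus; nothing K-uniform; no crux, rung or summit statement is
proved; the Yang–Mills mass gap is NOT proved.
-/

set_option autoImplicit false

noncomputable section

namespace Summit.QuantumFields.YangMills.Theorems.ColdStartUniversality

open MeasureTheory Finset Filter Set Metric Function unitInterval
open scoped NNReal Matrix ComplexConjugate Topology
open Literature.MathematicalPhysics.QuantumFieldTheory Literature.Analysis.ODE
open Literature.MathematicalPhysics.QuantumLattice (fundamentalRep fundamentalLatticeRep continuous_fundamentalRep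
  fundamentalRep_mem_unitaryGroup)

variable {L : ℕ}

/-! ## The global flow of the tamed equation, smooth in the start, bounds uniform in the path -/

/-- ★ **The Doss–Sussmann flow.**  Let `G` be a tamed field with constant `K` (smooth; `‖G(p,M)‖ ≤ K`, `‖DG(p,M)‖ ≤ K`
and `M ↦ G(p, M)` `K`-Lipschitz for all frames `‖p‖ ≤ 1`), `T ≥ 0`, and `c : [0,1] → Cfg` a continuous frame path with
`‖c(τ)‖ ≤ 1`.  Then the equation `v(τ) = x + ∫₀^τ T·G(c(s), v(s)) ds` has exactly one continuous solution `Φ x` from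
every `x`; `x ↦ Φ x` is `C^∞`; `‖D(x ↦ Φ x τ)(x₀)‖ ≤ exp(T K τ)` and `‖Φ x τ − x‖ ≤ T K τ` — bounds independent of `c`.
[folklore] -/
theorem exists_dossSussmannFlow [NeZero L]
    {G : (Edge 3 L → Fin (fundamentalLatticeRep 2).N → Fin (fundamentalLatticeRep 2).N → ℂ) ×
        (Edge 3 L → Fin (fundamentalLatticeRep 2).N → Fin (fundamentalLatticeRep 2).N → ℂ) →
        (Edge 3 L → Fin (fundamentalLatticeRep 2).N → Fin (fundamentalLatticeRep 2).N → ℂ)}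
    {K : ℝ≥0} (hG : ContDiff ℝ (⊤ : ℕ∞) G) (hK0 : ∀ p M, ‖p‖ ≤ 1 → ‖G (p, M)‖ ≤ K)
    (hK1 : ∀ p M, ‖p‖ ≤ 1 → ‖fderiv ℝ G (p, M)‖ ≤ K) (hK2 : ∀ p, ‖p‖ ≤ 1 → LipschitzWith K fun M => G (p, M))
    {T : ℝ} (hT : 0 ≤ T)
    (c : C(I, Edge 3 L → Fin (fundamentalLatticeRep 2).N → Fin (fundamentalLatticeRep 2).N → ℂ))
    (hc : ∀ τ, ‖c τ‖ ≤ 1) :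
    ∃ Φ : (Edge 3 L → Fin (fundamentalLatticeRep 2).N → Fin (fundamentalLatticeRep 2).N → ℂ) →
        C(I, Edge 3 L → Fin (fundamentalLatticeRep 2).N → Fin (fundamentalLatticeRep 2).N → ℂ),
      (∀ x (τ : I), Φ x τ = x + ∫ s in (0:ℝ)..(τ:ℝ),
        T • G (IccExtend zero_le_one c s, IccExtend zero_le_one (Φ x) s)) ∧
      (∀ x (α : C(I, Edge 3 L → Fin (fundamentalLatticeRep 2).N → Fin (fundamentalLatticeRep 2).N → ℂ)),
        (∀ τ : I, α τ = x + ∫ s in (0:ℝ)..(τ:ℝ),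
          T • G (IccExtend zero_le_one c s, IccExtend zero_le_one α s)) → α = Φ x) ∧
      ContDiff ℝ (⊤ : ℕ∞) Φ ∧
      (∀ x₀ (τ : I), ‖fderiv ℝ (fun x => Φ x τ) x₀‖ ≤ Real.exp (T * K * τ)) ∧
      (∀ x (τ : I), ‖Φ x τ - x‖ ≤ T * K * τ) := by
  let Cfg : Type := Edge 3 L → Fin (fundamentalLatticeRep 2).N → Fin (fundamentalLatticeRep 2).N → ℂ
  -- the rescaled field
  let GT : Cfg × Cfg → Cfg := fun q => T • G q
  have hGT : ContDiff ℝ (⊤ : ℕ∞) GT := hG.const_smul T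
  have hGTc : Continuous GT := hGT.continuous
  have hGd : Differentiable ℝ G := hG.differentiable (by simp)
  have hlip : ∀ s : I, LipschitzWith (‖T‖₊ * K) fun v => GT (c s, v) := fun s =>
    (lipschitzWith_smul T).comp (hK2 (c s) (hc s))
  obtain ⟨Φ, hΦ, huniq⟩ := exists_pathDriven_solution_family hGTc c hlip
  have hsmooth : ContDiff ℝ (⊤ : ℕ∞) Φ := contDiff_pathDriven_solution_family hGT le_top c hΦ huniq
  refine ⟨Φ, hΦ, huniq, hsmooth, fun x₀ τ => ?_, fun x τ => ?_⟩
  · -- derivative bound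
    have hA : 0 ≤ T * K := mul_nonneg hT K.2
    have hbound : ∀ (s : I) (v : Cfg), ‖fderiv ℝ GT (c s, Φ x₀ s) ((0 : Cfg), v)‖ ≤ T * K * ‖v‖ := by
      intro s v
      have hfd : fderiv ℝ GT (c s, Φ x₀ s) = T • fderiv ℝ G (c s, Φ x₀ s) :=
        fderiv_const_smul (hGd _) T
      rw [hfd]
      change ‖T • (fderiv ℝ G (c s, Φ x₀ s) ((0 : Cfg), v))‖ ≤ _
      rw [norm_smul, Real.norm_eq_abs, abs_of_nonneg hT, mul_assoc]
      refine mul_le_mul_of_nonneg_left ?_ hT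
      calc ‖fderiv ℝ G (c s, Φ x₀ s) ((0 : Cfg), v)‖
          ≤ ‖fderiv ℝ G (c s, Φ x₀ s)‖ * ‖((0 : Cfg), v)‖ := ContinuousLinearMap.le_opNorm _ _
        _ ≤ K * ‖v‖ := by
            have h0 : ‖((0 : Cfg), v)‖ ≤ ‖v‖ := by simp [Prod.norm_def]
            exact mul_le_mul (hK1 _ _ (hc s)) h0 (norm_nonneg _) K.2
    exact norm_fderiv_pathDriven_solution_family_eval_le hGT le_top c hΦ huniq x₀ hA hbound τ
  · -- displacement bound
    have hcont : Continuous fun s : ℝ => GT (IccExtend zero_le_one c s, IccExtend zero_le_one (Φ x) s) :=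
      hGTc.comp ((continuous_IccExtend_coe c).prodMk (continuous_IccExtend_coe (Φ x)))
    have hle : ∀ s : ℝ, ‖GT (IccExtend zero_le_one c s, IccExtend zero_le_one (Φ x) s)‖ ≤ T * K := by
      intro s
      simp only [GT, norm_smul, Real.norm_eq_abs, abs_of_nonneg hT]
      exact mul_le_mul_of_nonneg_left (hK0 _ _ (by simpa [Set.IccExtend] using hc _)) hT
    rw [hΦ x τ, add_sub_cancel_left]
    calc ‖∫ s in (0:ℝ)..(τ:ℝ), GT (IccExtend zero_le_one c s, IccExtend zero_le_one (Φ x) s)‖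
        ≤ (T * K) * |(τ : ℝ) - 0| := intervalIntegral.norm_integral_le_of_norm_le_const fun s _ => hle s
      _ = T * K * τ := by rw [sub_zero, abs_of_nonneg τ.2.1]

/-! ## The SZZ conjugated path solves the tamed path-driven equation -/

/-- Entries of a `ρ(SU(2))`-conjugated product `(ρg)ᴴ ρh` have modulus `≤ 1`, so the configuration
`e ↦ ((ρB_e)ᴴ ρU_e)` has sup norm `≤ 1` (unitarity). [folklore] -/
theorem norm_conjProduct_config_le_one [NeZero L]
    (g h : GaugeConfig 3 L (Matrix.specialUnitaryGroup (Fin 2) ℂ)) :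
    ‖(fun (e : Edge 3 L) (k l : Fin (fundamentalLatticeRep 2).N) =>
      (((fundamentalLatticeRep 2).ρ (g e))ᴴ * (fundamentalLatticeRep 2).ρ (h e)) k l)‖ ≤ 1 := by
  have hρu : ∀ g : Matrix.specialUnitaryGroup (Fin 2) ℂ,
      (fundamentalLatticeRep 2).ρ g ∈ Matrix.unitaryGroup (Fin (fundamentalLatticeRep 2).N) ℂ :=
    (fundamentalLatticeRep 2).mem_unitary
  refine (pi_norm_le_iff_of_nonneg zero_le_one).2 fun e => ?_
  refine (pi_norm_le_iff_of_nonneg zero_le_one).2 fun k => ?_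
  refine (pi_norm_le_iff_of_nonneg zero_le_one).2 fun l => ?_
  have hu : ((fundamentalLatticeRep 2).ρ (g e))ᴴ * (fundamentalLatticeRep 2).ρ (h e) ∈
      Matrix.unitaryGroup (Fin (fundamentalLatticeRep 2).N) ℂ := by
    rw [← Matrix.star_eq_conjTranspose]
    exact mul_mem (Unitary.star_mem (hρu (g e))) (hρu (h e))
  exact entry_norm_bound_of_unitary hu k l

/-- Entries of a `ρ(SU(2))`-valued configuration have modulus `≤ 1`: the frame path `ρB(t)` has sup norm `≤ 1`.
[folklore] -/
theorem norm_frame_config_le_one [NeZero L] (g : GaugeConfig 3 L (Matrix.specialUnitaryGroup (Fin 2) ℂ)) :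
    ‖(fun (e : Edge 3 L) (k l : Fin (fundamentalLatticeRep 2).N) => (fundamentalLatticeRep 2).ρ (g e) k l)‖ ≤ 1 := by
  refine (pi_norm_le_iff_of_nonneg zero_le_one).2 fun e => ?_
  refine (pi_norm_le_iff_of_nonneg zero_le_one).2 fun k => ?_
  refine (pi_norm_le_iff_of_nonneg zero_le_one).2 fun l => ?_
  exact entry_norm_bound_of_unitary ((fundamentalLatticeRep 2).mem_unitary (g e)) k l

/-- ★★ **The SZZ conjugated path is a solution of the tamed path-driven equation.**  Let `G` be continuous and agree
with the raw Doss–Sussmann field at all `‖M‖ ≤ 1`; let `B` be the free (`β = 0`) and `U` the coupling-`β` regular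
solution families driven by the same flat noise, started at `b`, `x`; `T ≥ 0`.  Almost surely: the frame path
`c(τ) = ρB(Tτ)` and the conjugated path `V(τ) = (ρB(Tτ))ᴴ ρU(Tτ)` are continuous on `[0, 1]` and
`V(τ) = (ρb)ᴴρx + ∫₀^τ T·G(c(s), V(s)) ds` — `V` is THE solution from `(ρb)ᴴρx` of the equation of
`exists_dossSussmannFlow` driven by `c` (time rescaled to `[0, 1]`; from `hasDerivWithinAt_dossSussmann_vec` and the
fundamental theorem of calculus, the taming being invisible along the unitary path). [folklore] -/
theorem dossSussmann_isPathDrivenSolution [NeZero L] (β : ℝ)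
    {G : (Edge 3 L → Fin (fundamentalLatticeRep 2).N → Fin (fundamentalLatticeRep 2).N → ℂ) ×
        (Edge 3 L → Fin (fundamentalLatticeRep 2).N → Fin (fundamentalLatticeRep 2).N → ℂ) →
        (Edge 3 L → Fin (fundamentalLatticeRep 2).N → Fin (fundamentalLatticeRep 2).N → ℂ)}
    (hGc : Continuous G)
    (hGF : ∀ p M, ‖M‖ ≤ 1 → G (p, M) = fun (e : Edge 3 L) (k l : Fin (fundamentalLatticeRep 2).N) =>
        ((Matrix.of (p e))ᴴ *
          (fundamentalLatticeRep 2).driftLie β (fun e' => Matrix.of (p e') * Matrix.of (M e')) e *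
          (Matrix.of (p e) * Matrix.of (M e))) k l)
    {Ω : Type} [MeasurableSpace Ω] {P : Measure Ω} [IsProbabilityMeasure P]
    {W : ℝ≥0 → Ω → (Edge 3 L × NoiseIdx 2 → ℝ)} (hW : IsFlatBrownian W P)
    (B U : GaugeConfig 3 L (Matrix.specialUnitaryGroup (Fin 2) ℂ) → ℝ≥0 → Ω →
      GaugeConfig 3 L (Matrix.specialUnitaryGroup (Fin 2) ℂ))
    (hB : ∀ x, (∀ ω, B x 0 ω = x) ∧
      (latticeLangevinDynamics (fundamentalLatticeRep 2) 0).IsSolution (fundamentalRep (Fin 2)) hW.natFiltration P W (B x))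
    (hBm : ∀ i : ℝ≥0, Measurable[@Prod.instMeasurableSpace (Set.Iic i)
        (GaugeConfig 3 L (Matrix.specialUnitaryGroup (Fin 2) ℂ) × Ω) inferInstance
        (@Prod.instMeasurableSpace (GaugeConfig 3 L (Matrix.specialUnitaryGroup (Fin 2) ℂ)) Ω inferInstance
          (hW.natFiltration i))]
      (fun q : Set.Iic i × (GaugeConfig 3 L (Matrix.specialUnitaryGroup (Fin 2) ℂ) × Ω) => B q.2.1 q.1 q.2.2))
    (hU : ∀ x, (∀ ω, U x 0 ω = x) ∧
      (latticeLangevinDynamics (fundamentalLatticeRep 2) β).IsSolution (fundamentalRep (Fin 2)) hW.natFiltration P W (U x))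
    (hUm : ∀ i : ℝ≥0, Measurable[@Prod.instMeasurableSpace (Set.Iic i)
        (GaugeConfig 3 L (Matrix.specialUnitaryGroup (Fin 2) ℂ) × Ω) inferInstance
        (@Prod.instMeasurableSpace (GaugeConfig 3 L (Matrix.specialUnitaryGroup (Fin 2) ℂ)) Ω inferInstance
          (hW.natFiltration i))]
      (fun q : Set.Iic i × (GaugeConfig 3 L (Matrix.specialUnitaryGroup (Fin 2) ℂ) × Ω) => U q.2.1 q.1 q.2.2))
    (b x : GaugeConfig 3 L (Matrix.specialUnitaryGroup (Fin 2) ℂ)) {T : ℝ} (hT : 0 ≤ T) :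
    ∀ᵐ ω ∂P,
      ∃ (hc : Continuous fun (τ : I) (e : Edge 3 L) (k l : Fin (fundamentalLatticeRep 2).N) =>
          (fundamentalLatticeRep 2).ρ (B b (T * (τ : ℝ)).toNNReal ω e) k l)
        (hV : Continuous fun (τ : I) (e : Edge 3 L) (k l : Fin (fundamentalLatticeRep 2).N) =>
          (((fundamentalLatticeRep 2).ρ (B b (T * (τ : ℝ)).toNNReal ω e))ᴴ *
            (fundamentalLatticeRep 2).ρ (U x (T * (τ : ℝ)).toNNReal ω e)) k l),
      ∀ τ : I,
        (⟨_, hV⟩ : C(I, Edge 3 L → Fin (fundamentalLatticeRep 2).N → Fin (fundamentalLatticeRep 2).N → ℂ)) τ =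
          (fun (e : Edge 3 L) (k l : Fin (fundamentalLatticeRep 2).N) =>
            (((fundamentalLatticeRep 2).ρ (b e))ᴴ * (fundamentalLatticeRep 2).ρ (x e)) k l) +
          ∫ s in (0:ℝ)..(τ:ℝ), T • G
            (IccExtend zero_le_one
              (⟨_, hc⟩ : C(I, Edge 3 L → Fin (fundamentalLatticeRep 2).N → Fin (fundamentalLatticeRep 2).N → ℂ)) s,
             IccExtend zero_le_one
              (⟨_, hV⟩ : C(I, Edge 3 L → Fin (fundamentalLatticeRep 2).N → Fin (fundamentalLatticeRep 2).N → ℂ))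
                s) := by
  let Cfg : Type := Edge 3 L → Fin (fundamentalLatticeRep 2).N → Fin (fundamentalLatticeRep 2).N → ℂ
  filter_upwards [hasDerivWithinAt_dossSussmann_vec L β hW B U hB hBm hU hUm b x, (hB b).2.continuous,
    (hU x).2.continuous] with ω hder hcB hcU
  -- the raw frame and conjugated paths in real time
  set cR : ℝ → Cfg := fun t e k l => (fundamentalLatticeRep 2).ρ (B b t.toNNReal ω e) k l with hcR
  set VR : ℝ → Cfg := fun t e k l =>
    (((fundamentalLatticeRep 2).ρ (B b t.toNNReal ω e))ᴴ * (fundamentalLatticeRep 2).ρ (U x t.toNNReal ω e)) k l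
    with hVR
  have hmatB : ∀ e, Continuous fun t : ℝ => (fundamentalLatticeRep 2).ρ (B b t.toNNReal ω e) := fun e =>
    (fundamentalLatticeRep 2).continuous.comp ((continuous_apply e).comp (hcB.comp continuous_real_toNNReal))
  have hmatU : ∀ e, Continuous fun t : ℝ => (fundamentalLatticeRep 2).ρ (U x t.toNNReal ω e) := fun e =>
    (fundamentalLatticeRep 2).continuous.comp ((continuous_apply e).comp (hcU.comp continuous_real_toNNReal))
  have hcRc : Continuous cR :=
    continuous_pi fun e => continuous_pi fun k => continuous_pi fun l => (hmatB e).matrix_elem k l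
  have hVRc : Continuous VR :=
    continuous_pi fun e => continuous_pi fun k => continuous_pi fun l =>
      ((hmatB e).matrix_conjTranspose.matrix_mul (hmatU e)).matrix_elem k l
  -- rescaled paths on `[0, 1]`
  have hsc : Continuous fun τ : I => T * (τ : ℝ) := continuous_const.mul continuous_subtype_val
  have hc : Continuous fun (τ : I) => cR (T * (τ : ℝ)) := hcRc.comp hsc
  have hV : Continuous fun (τ : I) => VR (T * (τ : ℝ)) := hVRc.comp hsc
  refine ⟨hc, hV, ?_⟩
  set c : C(I, Cfg) := ⟨fun τ : I => cR (T * (τ : ℝ)), hc⟩ with hcdef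
  -- the rescaled path `Ṽ(t) = VR(Tt)` on `ℝ` and its right derivative
  set Vt : ℝ → Cfg := fun t => VR (T * t) with hVt
  have hVtc : ContinuousOn Vt (Icc 0 1) := (hVRc.comp (continuous_const.mul continuous_id)).continuousOn
  have hVt0 : Vt 0 = fun (e : Edge 3 L) (k l : Fin (fundamentalLatticeRep 2).N) =>
      (((fundamentalLatticeRep 2).ρ (b e))ᴴ * (fundamentalLatticeRep 2).ρ (x e)) k l := by
    have hB0 : B b (T * 0).toNNReal ω = b := by rw [mul_zero, Real.toNNReal_zero]; exact (hB b).1 ω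
    have hU0 : U x (T * 0).toNNReal ω = x := by rw [mul_zero, Real.toNNReal_zero]; exact (hU x).1 ω
    show VR (T * 0) = _
    simp only [hVR]
    rw [hB0, hU0]
  -- the taming is invisible along the unitary path
  have hVle : ∀ t : ℝ, ‖Vt t‖ ≤ 1 := fun t =>
    norm_conjProduct_config_le_one (L := L) (fun e => B b (T * t).toNNReal ω e) (fun e => U x (T * t).toNNReal ω e)
  have hfield : ∀ t : ℝ, G (cR (T * t), Vt t) =
      fun (e : Edge 3 L) (k l : Fin (fundamentalLatticeRep 2).N) =>
        (((fundamentalLatticeRep 2).ρ (B b (T * t).toNNReal ω e))ᴴ *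
          (fundamentalLatticeRep 2).driftLie β
            (fun e' => (fundamentalLatticeRep 2).ρ (B b (T * t).toNNReal ω e') * Matrix.of (Vt t e')) e *
          ((fundamentalLatticeRep 2).ρ (B b (T * t).toNNReal ω e) * Matrix.of (Vt t e))) k l := by
    intro t
    rw [hGF _ _ (hVle t)]
    rfl
  have hder' : ∀ t ∈ Ico (0:ℝ) 1, HasDerivWithinAt Vt (T • G (IccExtend zero_le_one c t, Vt t)) (Ici t) t := by
    intro t ht
    have hTt : 0 ≤ T * t := mul_nonneg hT ht.1
    have h1 := hder (T * t) hTt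
    have h2 : HasDerivWithinAt (fun s : ℝ => T * s) T (Ici t) t := by
      simpa using ((hasDerivWithinAt_id t (Ici t)).const_mul T)
    have hmaps : MapsTo (fun s : ℝ => T * s) (Ici t) (Ici 0) := fun s hs =>
      mul_nonneg hT (ht.1.trans hs)
    have h3 := h1.scomp t h2 hmaps
    have hct : IccExtend zero_le_one c t = cR (T * t) := by
      rw [IccExtend_of_mem _ _ (Ico_subset_Icc_self ht), hcdef]
      rfl
    rw [hct, hfield t]
    exact h3
  have hGTc : Continuous fun q : Cfg × Cfg => T • G q := hGc.const_smul T
  obtain ⟨hcont, hsol⟩ := pathDriven_solution_of_hasDerivWithinAt (G := fun q : Cfg × Cfg => T • G q)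
    hGTc c hVt0 hVtc hder'
  exact hsol

/-- ★★ **Doss–Sussmann flow representation `U = B · Φ^{B}((ρb)ᴴρx)`.**  In the setting of
`dossSussmann_isPathDrivenSolution`: almost surely, for EVERY solution family `Φ` of the tamed path-driven equation
driven by the frame path `c(τ) = ρB(Tτ)` that is unique from every start (e.g. the flow of `exists_dossSussmannFlow`),
`ρU_e(Tτ) = ρB_e(Tτ) · Φ((ρb)ᴴρx)(τ)_e` for all `τ ∈ [0, 1]` and all links `e`: the SZZ solution at coupling `β` is the
FREE Brownian motion times a deterministic smooth functional of the Brownian path and the start (memo g23 §3, N2).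
[folklore] -/
theorem dossSussmann_flow_representation [NeZero L] (β : ℝ)
    {G : (Edge 3 L → Fin (fundamentalLatticeRep 2).N → Fin (fundamentalLatticeRep 2).N → ℂ) ×
        (Edge 3 L → Fin (fundamentalLatticeRep 2).N → Fin (fundamentalLatticeRep 2).N → ℂ) →
        (Edge 3 L → Fin (fundamentalLatticeRep 2).N → Fin (fundamentalLatticeRep 2).N → ℂ)}
    (hGc : Continuous G)
    (hGF : ∀ p M, ‖M‖ ≤ 1 → G (p, M) = fun (e : Edge 3 L) (k l : Fin (fundamentalLatticeRep 2).N) =>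
        ((Matrix.of (p e))ᴴ *
          (fundamentalLatticeRep 2).driftLie β (fun e' => Matrix.of (p e') * Matrix.of (M e')) e *
          (Matrix.of (p e) * Matrix.of (M e))) k l)
    {Ω : Type} [MeasurableSpace Ω] {P : Measure Ω} [IsProbabilityMeasure P]
    {W : ℝ≥0 → Ω → (Edge 3 L × NoiseIdx 2 → ℝ)} (hW : IsFlatBrownian W P)
    (B U : GaugeConfig 3 L (Matrix.specialUnitaryGroup (Fin 2) ℂ) → ℝ≥0 → Ω →
      GaugeConfig 3 L (Matrix.specialUnitaryGroup (Fin 2) ℂ))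
    (hB : ∀ x, (∀ ω, B x 0 ω = x) ∧
      (latticeLangevinDynamics (fundamentalLatticeRep 2) 0).IsSolution (fundamentalRep (Fin 2)) hW.natFiltration P W (B x))
    (hBm : ∀ i : ℝ≥0, Measurable[@Prod.instMeasurableSpace (Set.Iic i)
        (GaugeConfig 3 L (Matrix.specialUnitaryGroup (Fin 2) ℂ) × Ω) inferInstance
        (@Prod.instMeasurableSpace (GaugeConfig 3 L (Matrix.specialUnitaryGroup (Fin 2) ℂ)) Ω inferInstance
          (hW.natFiltration i))]
      (fun q : Set.Iic i × (GaugeConfig 3 L (Matrix.specialUnitaryGroup (Fin 2) ℂ) × Ω) => B q.2.1 q.1 q.2.2))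
    (hU : ∀ x, (∀ ω, U x 0 ω = x) ∧
      (latticeLangevinDynamics (fundamentalLatticeRep 2) β).IsSolution (fundamentalRep (Fin 2)) hW.natFiltration P W (U x))
    (hUm : ∀ i : ℝ≥0, Measurable[@Prod.instMeasurableSpace (Set.Iic i)
        (GaugeConfig 3 L (Matrix.specialUnitaryGroup (Fin 2) ℂ) × Ω) inferInstance
        (@Prod.instMeasurableSpace (GaugeConfig 3 L (Matrix.specialUnitaryGroup (Fin 2) ℂ)) Ω inferInstance
          (hW.natFiltration i))]
      (fun q : Set.Iic i × (GaugeConfig 3 L (Matrix.specialUnitaryGroup (Fin 2) ℂ) × Ω) => U q.2.1 q.1 q.2.2))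
    (b x : GaugeConfig 3 L (Matrix.specialUnitaryGroup (Fin 2) ℂ)) {T : ℝ} (hT : 0 ≤ T) :
    ∀ᵐ ω ∂P,
      ∃ (hc : Continuous fun (τ : I) (e : Edge 3 L) (k l : Fin (fundamentalLatticeRep 2).N) =>
          (fundamentalLatticeRep 2).ρ (B b (T * (τ : ℝ)).toNNReal ω e) k l),
      ∀ Φ : (Edge 3 L → Fin (fundamentalLatticeRep 2).N → Fin (fundamentalLatticeRep 2).N → ℂ) →
          C(I, Edge 3 L → Fin (fundamentalLatticeRep 2).N → Fin (fundamentalLatticeRep 2).N → ℂ),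
        (∀ x' (α : C(I, Edge 3 L → Fin (fundamentalLatticeRep 2).N → Fin (fundamentalLatticeRep 2).N → ℂ)),
          (∀ τ : I, α τ = x' + ∫ s in (0:ℝ)..(τ:ℝ), T • G
            (IccExtend zero_le_one
              (⟨_, hc⟩ : C(I, Edge 3 L → Fin (fundamentalLatticeRep 2).N → Fin (fundamentalLatticeRep 2).N → ℂ)) s,
             IccExtend zero_le_one α s)) → α = Φ x') →
        ∀ (τ : I) (e : Edge 3 L),
          (fundamentalLatticeRep 2).ρ (U x (T * (τ : ℝ)).toNNReal ω e) =
            (fundamentalLatticeRep 2).ρ (B b (T * (τ : ℝ)).toNNReal ω e) *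
              Matrix.of (Φ (fun (e : Edge 3 L) (k l : Fin (fundamentalLatticeRep 2).N) =>
                (((fundamentalLatticeRep 2).ρ (b e))ᴴ * (fundamentalLatticeRep 2).ρ (x e)) k l) τ e) := by
  have hρu : ∀ g : Matrix.specialUnitaryGroup (Fin 2) ℂ,
      (fundamentalLatticeRep 2).ρ g ∈ Matrix.unitaryGroup (Fin (fundamentalLatticeRep 2).N) ℂ :=
    (fundamentalLatticeRep 2).mem_unitary
  filter_upwards [dossSussmann_isPathDrivenSolution (L := L) β hGc hGF hW B U hB hBm hU hUm b x hT] with ω hω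
  obtain ⟨hc, hV, hsol⟩ := hω
  refine ⟨hc, fun Φ huniq τ e => ?_⟩
  have hΦ := huniq _ _ hsol
  rw [← hΦ]
  -- `ρB · (ρB)ᴴ ρU = ρU`
  have hu : (fundamentalLatticeRep 2).ρ (B b (T * (τ : ℝ)).toNNReal ω e) *
      ((fundamentalLatticeRep 2).ρ (B b (T * (τ : ℝ)).toNNReal ω e))ᴴ = 1 := by
    rw [← Matrix.star_eq_conjTranspose]; exact Matrix.mem_unitaryGroup_iff.1 (hρu _)
  have hof : Matrix.of ((⟨_, hV⟩ : C(I, Edge 3 L → Fin (fundamentalLatticeRep 2).N →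
      Fin (fundamentalLatticeRep 2).N → ℂ)) τ e) =
      ((fundamentalLatticeRep 2).ρ (B b (T * (τ : ℝ)).toNNReal ω e))ᴴ *
        (fundamentalLatticeRep 2).ρ (U x (T * (τ : ℝ)).toNNReal ω e) := by
    ext k l; rfl
  rw [hof, ← Matrix.mul_assoc, hu, Matrix.one_mul]

end Summit.QuantumFields.YangMills.Theorems.ColdStartUniversality

end
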